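import Literature.NumberTheory.LFunctions.WeilFirstPrimeCertificateDataA
import Literature.NumberTheory.LFunctions.WeilBlockRows
import HarnessLib

/-!
# First-prime Weil positivity on `C(2/5)`: kernel check of the parity block `0`, rows `0 … 12`

Sibling of `WeilFirstPrimeCertificateDataA.lean`: the even parity block of
`weilCert2A` passes `WeilCert.checkBlockK` (`D C = I`; `R = S' − UᵀU` diagonally dominant), evaluated
ROW BY ROW (`WeilCert.checkDCRow`, `WeilCert.checkDomRow` of `WeilBlockRows.lean`, one kernel evaluation per
row, run sequentially — `Elab.async false` — to bound memory) and assembled by `WeilCert.checkBlockK_of_rows`.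
-/

set_option Elab.async false

noncomputable section

namespace Literature.NumberTheory.LFunctions

/-- Row `0` of `D C = I`, block `0`. [folklore] -/
theorem weilCert2A_dc0_0 : weilCert2A.base.checkDCRow 0 0 = true := by
  decide +kernel

/-- Row `0` of the dominance test of `R = S' − UᵀU`, block `0`. [folklore] -/
theorem weilCert2A_dom0_0 :
    weilCert2A.base.checkDomRow weilCert2A.nuTab weilCert2A.kappaQ 0 0 = true := by
  decide +kernel

/-- Row `1` of `D C = I`, block `0`. [folklore] -/
theorem weilCert2A_dc0_1 : weilCert2A.base.checkDCRow 0 1 = true := by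
  decide +kernel

/-- Row `1` of the dominance test of `R = S' − UᵀU`, block `0`. [folklore] -/
theorem weilCert2A_dom0_1 :
    weilCert2A.base.checkDomRow weilCert2A.nuTab weilCert2A.kappaQ 0 1 = true := by
  decide +kernel

/-- Row `2` of `D C = I`, block `0`. [folklore] -/
theorem weilCert2A_dc0_2 : weilCert2A.base.checkDCRow 0 2 = true := by
  decide +kernel

/-- Row `2` of the dominance test of `R = S' − UᵀU`, block `0`. [folklore] -/
theorem weilCert2A_dom0_2 :
    weilCert2A.base.checkDomRow weilCert2A.nuTab weilCert2A.kappaQ 0 2 = true := by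
  decide +kernel

/-- Row `3` of `D C = I`, block `0`. [folklore] -/
theorem weilCert2A_dc0_3 : weilCert2A.base.checkDCRow 0 3 = true := by
  decide +kernel

/-- Row `3` of the dominance test of `R = S' − UᵀU`, block `0`. [folklore] -/
theorem weilCert2A_dom0_3 :
    weilCert2A.base.checkDomRow weilCert2A.nuTab weilCert2A.kappaQ 0 3 = true := by
  decide +kernel

/-- Row `4` of `D C = I`, block `0`. [folklore] -/
theorem weilCert2A_dc0_4 : weilCert2A.base.checkDCRow 0 4 = true := by
  decide +kernel

/-- Row `4` of the dominance test of `R = S' − UᵀU`, block `0`. [folklore] -/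
theorem weilCert2A_dom0_4 :
    weilCert2A.base.checkDomRow weilCert2A.nuTab weilCert2A.kappaQ 0 4 = true := by
  decide +kernel

/-- Row `5` of `D C = I`, block `0`. [folklore] -/
theorem weilCert2A_dc0_5 : weilCert2A.base.checkDCRow 0 5 = true := by
  decide +kernel

/-- Row `5` of the dominance test of `R = S' − UᵀU`, block `0`. [folklore] -/
theorem weilCert2A_dom0_5 :
    weilCert2A.base.checkDomRow weilCert2A.nuTab weilCert2A.kappaQ 0 5 = true := by
  decide +kernel

/-- Row `6` of `D C = I`, block `0`. [folklore] -/
theorem weilCert2A_dc0_6 : weilCert2A.base.checkDCRow 0 6 = true := by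
  decide +kernel

/-- Row `6` of the dominance test of `R = S' − UᵀU`, block `0`. [folklore] -/
theorem weilCert2A_dom0_6 :
    weilCert2A.base.checkDomRow weilCert2A.nuTab weilCert2A.kappaQ 0 6 = true := by
  decide +kernel

/-- Row `7` of `D C = I`, block `0`. [folklore] -/
theorem weilCert2A_dc0_7 : weilCert2A.base.checkDCRow 0 7 = true := by
  decide +kernel

/-- Row `7` of the dominance test of `R = S' − UᵀU`, block `0`. [folklore] -/
theorem weilCert2A_dom0_7 :
    weilCert2A.base.checkDomRow weilCert2A.nuTab weilCert2A.kappaQ 0 7 = true := by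
  decide +kernel

/-- Row `8` of `D C = I`, block `0`. [folklore] -/
theorem weilCert2A_dc0_8 : weilCert2A.base.checkDCRow 0 8 = true := by
  decide +kernel

/-- Row `8` of the dominance test of `R = S' − UᵀU`, block `0`. [folklore] -/
theorem weilCert2A_dom0_8 :
    weilCert2A.base.checkDomRow weilCert2A.nuTab weilCert2A.kappaQ 0 8 = true := by
  decide +kernel

/-- Row `9` of `D C = I`, block `0`. [folklore] -/
theorem weilCert2A_dc0_9 : weilCert2A.base.checkDCRow 0 9 = true := by
  decide +kernel

/-- Row `9` of the dominance test of `R = S' − UᵀU`, block `0`. [folklore] -/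
theorem weilCert2A_dom0_9 :
    weilCert2A.base.checkDomRow weilCert2A.nuTab weilCert2A.kappaQ 0 9 = true := by
  decide +kernel

/-- Row `10` of `D C = I`, block `0`. [folklore] -/
theorem weilCert2A_dc0_10 : weilCert2A.base.checkDCRow 0 10 = true := by
  decide +kernel

/-- Row `10` of the dominance test of `R = S' − UᵀU`, block `0`. [folklore] -/
theorem weilCert2A_dom0_10 :
    weilCert2A.base.checkDomRow weilCert2A.nuTab weilCert2A.kappaQ 0 10 = true := by
  decide +kernel

/-- Row `11` of `D C = I`, block `0`. [folklore] -/
theorem weilCert2A_dc0_11 : weilCert2A.base.checkDCRow 0 11 = true := by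
  decide +kernel

/-- Row `11` of the dominance test of `R = S' − UᵀU`, block `0`. [folklore] -/
theorem weilCert2A_dom0_11 :
    weilCert2A.base.checkDomRow weilCert2A.nuTab weilCert2A.kappaQ 0 11 = true := by
  decide +kernel

/-- Row `12` of `D C = I`, block `0`. [folklore] -/
theorem weilCert2A_dc0_12 : weilCert2A.base.checkDCRow 0 12 = true := by
  decide +kernel

/-- Row `12` of the dominance test of `R = S' − UᵀU`, block `0`. [folklore] -/
theorem weilCert2A_dom0_12 :
    weilCert2A.base.checkDomRow weilCert2A.nuTab weilCert2A.kappaQ 0 12 = true := by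
  decide +kernel

end Literature.NumberTheory.LFunctions
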